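import Mathlib.Analysis.SpecialFunctions.Gamma.Beta
import Mathlib.Analysis.SpecialFunctions.Pow.Deriv
import Mathlib.Analysis.SpecialFunctions.Integrability.Basic
import Mathlib.Analysis.Complex.CauchyIntegral
import Mathlib.MeasureTheory.Integral.Bochner.ContinuousLinearMap
import Mathlib.MeasureTheory.Function.SpecialFunctions.Basic
import HarnessLib

/-!
# Montgomery 1983, §4 — the truncated vertical Hankel integral `(1/2πi)∫_{1-iA}^{1+iA} w^{-β}e^{w}dw = 1/Γ(β) + O(A^{-β})`

Proofs-only companion of `Literature/Barriers/RiemannHypothesis/TuranPartialSums.lean` (named fact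
`Literature.Barriers.RiemannHypothesis.Montgomery1983_theorem`, Montgomery 1983, Theorem p. 497) and of
`TuranPartialSumsMontgomeryRouche.lean`. No definitions, no named facts; everything is proved.

In §4 of the source the main term of the twisted section comes from the loop `Γ₁` about the
singularity of `f(s+w)` at `w = 1 + i − s`: "This latter integral is
`= 2iΓ(1−b̂(1))(sin π b̂(1))(log N)^{b̂(1)−1}`", i.e. Hankel's loop integral
`∫_C z^{-b} N^{z} dz = 2i Γ(1−b) sin(πb) (log N)^{b−1}` (p. 505). The formalisation evaluates the same
main term on the *vertical* line `Re(s+w) = 1 + 1/log N` instead of a loop (no analytic continuation of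
`log ζ` is then needed), where after the rescaling `w = z log N` it becomes the truncated Laplace
inversion integral for `t^{β−1}/Γ(β)` at `t = 1`:

* `norm_hankelLineIntegral_sub_le`: for `0 < β < 1` and `A > 0`,
  `‖∫_{-A}^{A} (1+iy)^{-β} e^{1+iy} dy − 2π/Γ(β)‖ ≤ 2e·A^{-β}`.

Proof (classical; e.g. Whittaker–Watson §12.22, Hankel's contour, run backwards): Cauchy's theorem for
`w^{-β}e^{w}` (principal branch) on the rectangle `[-R,1] × [ε,A]` (`hankel_rect_eq_zero`); the top edge is
`≤ e·A^{-β}` and the far edge `≤ A·R^{-β}e^{-R}` (`norm_hankel_top_le`, `norm_hankel_left_le`); as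
`ε → 0⁺` the bottom edge tends to the integral along the cut, by dominated convergence with the
majorant `e|x|^{-β}` and continuity of the principal branch from above (`tendsto_hankel_bottom`,
`continuousWithinAt_hankelKernel`), whose imaginary part is `−sin(πβ)∫_0^R r^{-β}e^{-r}dr`
(`im_hankel_bottom_zero`, from `x^{-β} = |x|^{-β}e^{-iπβ}` on the cut); the lower half-plane is the
complex conjugate of the upper one (`hankel_line_eq_two_re`); finally `R → ∞`,
`∫_0^∞ r^{-β}e^{-r}dr = Γ(1−β)` (Mathlib's `Real.Gamma_eq_integral`) and the reflection formula
`Γ(β)Γ(1−β) = π/sin(πβ)` (Mathlib's `Real.Gamma_mul_Gamma_one_sub`).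

## References

* [Montgomery1983] H. L. Montgomery, *Zeros of approximations to the zeta function*, Studies in Pure
  Mathematics (Turán memorial), Birkhäuser 1983, 497–506: §4, p. 505 (the evaluation of `∫_{Γ₁}`).
* E. T. Whittaker, G. N. Watson, *A Course of Modern Analysis*, 4th ed., §12.22 (Hankel's contour
  integral for `1/Γ`). [folklore]
-/

noncomputable section

open Complex Set MeasureTheory Filter Topology intervalIntegral
open scoped Interval

namespace Literature.Barriers.RiemannHypothesis

/-! ## The Hankel kernel `w^{-β} e^{w}` -/

/-- `‖w^{-β}‖ = ‖w‖^{-β}` for real `β`. [folklore] -/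
theorem norm_cpow_neg_ofReal (w : ℂ) (β : ℝ) : ‖w ^ (-(β : ℂ))‖ = ‖w‖ ^ (-β) := by
  rw [show (-(β : ℂ)) = ((-β : ℝ) : ℂ) by push_cast; ring, norm_cpow_real]

/-- `‖w^{-β} e^{w}‖ = ‖w‖^{-β} e^{Re w}`. [folklore] -/
theorem norm_hankelKernel (w : ℂ) (β : ℝ) :
    ‖w ^ (-(β : ℂ)) * exp w‖ = ‖w‖ ^ (-β) * Real.exp w.re := by
  rw [norm_mul, norm_cpow_neg_ofReal, norm_exp]

/-- The kernel is complex differentiable off the cut `(-∞, 0]`. [folklore] -/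
theorem differentiableAt_hankelKernel {w : ℂ} (hw : w ∈ slitPlane) (β : ℝ) :
    DifferentiableAt ℂ (fun w : ℂ ↦ w ^ (-(β : ℂ)) * exp w) w :=
  (differentiableAt_id.cpow_const (by simpa using hw)).mul differentiable_exp.differentiableAt

/-- On the horizontal line at height `A > 0`: `‖(x+iA)^{-β} e^{x+iA}‖ ≤ A^{-β} eˣ` (`β ≥ 0`).
[folklore] -/
theorem norm_hankelKernel_top_le {A β : ℝ} (hA : 0 < A) (hβ : 0 ≤ β) (x : ℝ) :
    ‖((x : ℂ) + A * I) ^ (-(β : ℂ)) * exp ((x : ℂ) + A * I)‖ ≤ A ^ (-β) * Real.exp x := by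
  rw [norm_hankelKernel]
  have hre : ((x : ℂ) + A * I).re = x := by simp
  rw [hre]
  refine mul_le_mul_of_nonneg_right ?_ (Real.exp_pos x).le
  refine Real.rpow_le_rpow_of_nonpos hA ?_ (by linarith)
  calc A = |((x : ℂ) + A * I).im| := by simp [abs_of_pos hA]
    _ ≤ ‖(x : ℂ) + A * I‖ := abs_im_le_norm _

/-- On the vertical line `Re w = -R < 0`: `‖(-R+iy)^{-β} e^{-R+iy}‖ ≤ R^{-β} e^{-R}` (`β ≥ 0`).
[folklore] -/
theorem norm_hankelKernel_left_le {R β : ℝ} (hR : 0 < R) (hβ : 0 ≤ β) (y : ℝ) :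
    ‖(-(R : ℂ) + y * I) ^ (-(β : ℂ)) * exp (-(R : ℂ) + y * I)‖ ≤ R ^ (-β) * Real.exp (-R) := by
  rw [norm_hankelKernel]
  have hre : (-(R : ℂ) + y * I).re = -R := by simp
  rw [hre]
  refine mul_le_mul_of_nonneg_right ?_ (Real.exp_pos _).le
  refine Real.rpow_le_rpow_of_nonpos hR ?_ (by linarith)
  calc R = |(-(R : ℂ) + y * I).re| := by simp [abs_of_pos hR]
    _ ≤ ‖-(R : ℂ) + y * I‖ := abs_re_le_norm _

/-- On the vertical line `Re w = 1`: `‖(1+iy)^{-β} e^{1+iy}‖ ≤ e` (`β ≥ 0`). [folklore] -/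
theorem norm_hankelKernel_right_le {β : ℝ} (hβ : 0 ≤ β) (y : ℝ) :
    ‖((1 : ℂ) + y * I) ^ (-(β : ℂ)) * exp ((1 : ℂ) + y * I)‖ ≤ Real.exp 1 := by
  rw [norm_hankelKernel]
  have hre : ((1 : ℂ) + y * I).re = 1 := by simp
  rw [hre]
  have h1 : 1 ≤ ‖(1 : ℂ) + y * I‖ := by
    calc (1 : ℝ) = |((1 : ℂ) + y * I).re| := by simp
      _ ≤ ‖(1 : ℂ) + y * I‖ := abs_re_le_norm _
  have : ‖(1 : ℂ) + y * I‖ ^ (-β) ≤ 1 := by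
    have := Real.rpow_le_rpow_of_nonpos one_pos h1 (show -β ≤ 0 by linarith)
    rwa [Real.one_rpow] at this
  calc ‖(1 : ℂ) + y * I‖ ^ (-β) * Real.exp 1 ≤ 1 * Real.exp 1 :=
        mul_le_mul_of_nonneg_right this (Real.exp_pos 1).le
    _ = Real.exp 1 := one_mul _

/-- Continuity of the kernel along the horizontal line at height `A > 0`. [folklore] -/
theorem continuous_hankelKernel_horizontal {A : ℝ} (hA : 0 < A) (β : ℝ) :
    Continuous fun x : ℝ ↦ ((x : ℂ) + A * I) ^ (-(β : ℂ)) * exp ((x : ℂ) + A * I) := by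
  have hc : Continuous fun x : ℝ ↦ (x : ℂ) + A * I := by fun_prop
  refine continuous_iff_continuousAt.2 fun x ↦ ?_
  have hslit : ((x : ℂ) + A * I) ∈ slitPlane := Or.inr (by simp [hA.ne'])
  exact (differentiableAt_hankelKernel hslit β).continuousAt.comp
    (f := fun x : ℝ ↦ (x : ℂ) + A * I) hc.continuousAt

/-- Continuity of the kernel along the vertical line `Re w = a > 0`. [folklore] -/
theorem continuous_hankelKernel_vertical_of_pos {a : ℝ} (ha : 0 < a) (β : ℝ) :
    Continuous fun y : ℝ ↦ ((a : ℂ) + y * I) ^ (-(β : ℂ)) * exp ((a : ℂ) + y * I) := by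
  have hc : Continuous fun y : ℝ ↦ (a : ℂ) + y * I := by fun_prop
  refine continuous_iff_continuousAt.2 fun y ↦ ?_
  have hslit : ((a : ℂ) + y * I) ∈ slitPlane := Or.inl (by simp [ha])
  exact (differentiableAt_hankelKernel hslit β).continuousAt.comp
    (f := fun y : ℝ ↦ (a : ℂ) + y * I) hc.continuousAt

/-- The kernel is continuous *within the closed upper half-plane* at every `w ≠ 0` (on the cut
`(-∞,0)` this is continuity from above of the principal branch). [folklore] -/
theorem continuousWithinAt_hankelKernel {w : ℂ} (hw : w ≠ 0) (β : ℝ) :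
    ContinuousWithinAt (fun w : ℂ ↦ w ^ (-(β : ℂ)) * exp w) {z : ℂ | 0 ≤ z.im} w := by
  by_cases h : w ∈ slitPlane
  · exact (differentiableAt_hankelKernel h β).continuousAt.continuousWithinAt
  · rw [mem_slitPlane_iff, not_or, not_lt, not_ne_iff] at h
    have him : w.im = 0 := h.2
    have hre : w.re < 0 := by
      rcases h.1.lt_or_eq with hlt | heq
      · exact hlt
      · exact absurd (Complex.ext heq him) hw
    have hlog := continuousWithinAt_log_of_re_neg_of_im_zero hre him
    have h1 : ContinuousWithinAt (fun z : ℂ ↦ exp (log z * (-(β : ℂ))) * exp z)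
        {z : ℂ | 0 ≤ z.im} w :=
      ((hlog.mul continuousWithinAt_const).cexp).mul continuous_exp.continuousWithinAt
    refine h1.congr_of_eventuallyEq ?_ (by rw [cpow_def_of_ne_zero hw])
    have hne : ∀ᶠ z in 𝓝[{z : ℂ | 0 ≤ z.im}] w, z ≠ 0 :=
      mem_nhdsWithin_of_mem_nhds (isOpen_ne.mem_nhds hw)
    filter_upwards [hne] with z hz
    rw [cpow_def_of_ne_zero hz]

/-- Hence the kernel is measurable along any line `x ↦ x + iε`, `y ↦ a + iy`. [folklore] -/
theorem measurable_hankelKernel_horizontal (ε β : ℝ) :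
    Measurable fun x : ℝ ↦ ((x : ℂ) + ε * I) ^ (-(β : ℂ)) * exp ((x : ℂ) + ε * I) := by
  have h1 : Measurable fun x : ℝ ↦ (x : ℂ) + ε * I :=
    Complex.measurable_ofReal.add_const _
  exact (h1.pow_const _).mul (Complex.measurable_exp.comp h1)

/-- Continuity of the kernel along the vertical line `Re w = -R ≠ 0` on the closed half-line
`y ≥ 0` (at `y = 0` from above). [folklore] -/
theorem continuousOn_hankelKernel_left {R : ℝ} (hR : R ≠ 0) (β : ℝ) :
    ContinuousOn (fun y : ℝ ↦ (-(R : ℂ) + y * I) ^ (-(β : ℂ)) * exp (-(R : ℂ) + y * I))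
      (Ici 0) := by
  intro y hy
  have hc : Continuous fun y : ℝ ↦ -(R : ℂ) + y * I := by fun_prop
  have hne : (-(R : ℂ) + y * I) ≠ 0 := by
    intro h0
    have := congrArg Complex.re h0
    simp [hR] at this
  have hmaps : MapsTo (fun y : ℝ ↦ -(R : ℂ) + y * I) (Ici 0) {z : ℂ | 0 ≤ z.im} := by
    intro y' hy'
    simpa using hy'
  exact (continuousWithinAt_hankelKernel hne β).comp (f := fun y : ℝ ↦ -(R : ℂ) + y * I)
    hc.continuousWithinAt hmaps

/-! ## Cauchy's theorem on the upper rectangle `[-R, 1] × [ε, A]` -/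

/-- Cauchy–Goursat for the kernel on `[-R,1] × [ε,A]` (`0 < ε ≤ A`), which avoids the cut: in
Mathlib's four-term convention, bottom − top + i·right − i·left = 0. [folklore] -/
theorem hankel_rect_eq_zero {R ε A : ℝ} (hε : 0 < ε) (hεA : ε ≤ A) (β : ℝ) :
    (∫ x : ℝ in (-R)..1, ((x : ℂ) + ε * I) ^ (-(β : ℂ)) * exp ((x : ℂ) + ε * I)) -
      (∫ x : ℝ in (-R)..1, ((x : ℂ) + A * I) ^ (-(β : ℂ)) * exp ((x : ℂ) + A * I)) +
      I * (∫ y : ℝ in ε..A, ((1 : ℂ) + y * I) ^ (-(β : ℂ)) * exp ((1 : ℂ) + y * I)) -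
      I * (∫ y : ℝ in ε..A, (-(R : ℂ) + y * I) ^ (-(β : ℂ)) * exp (-(R : ℂ) + y * I)) = 0 := by
  have hd : DifferentiableOn ℂ (fun w : ℂ ↦ w ^ (-(β : ℂ)) * exp w)
      ([[(-R : ℝ), 1]] ×ℂ [[ε, A]]) := by
    intro w hw
    refine (differentiableAt_hankelKernel ?_ β).differentiableWithinAt
    refine Or.inr ?_
    have : w.im ∈ [[ε, A]] := hw.2
    rw [uIcc_of_le hεA] at this
    exact (lt_of_lt_of_le hε this.1).ne'
  have h := Complex.integral_boundary_rect_eq_zero_of_differentiableOn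
    (fun w : ℂ ↦ w ^ (-(β : ℂ)) * exp w) ((-R : ℝ) + ε * I) (1 + A * I)
    (by simpa using hd)
  simp only [add_re, ofReal_re, mul_re, I_re, mul_zero, ofReal_im, I_im, mul_one, sub_self,
    add_zero, add_im, mul_im, zero_add, one_re, one_im, smul_eq_mul] at h
  simpa using h

/-! ## Bounds for the top, left and right edges -/

/-- Top edge: `‖∫_{-R}^{1} (x+iA)^{-β} e^{x+iA} dx‖ ≤ e · A^{-β}` (`A > 0`, `R ≥ -1`, `β ≥ 0`).
[folklore] -/
theorem norm_hankel_top_le {R A β : ℝ} (hR : -1 ≤ R) (hA : 0 < A) (hβ : 0 ≤ β) :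
    ‖∫ x : ℝ in (-R)..1, ((x : ℂ) + A * I) ^ (-(β : ℂ)) * exp ((x : ℂ) + A * I)‖
      ≤ Real.exp 1 * A ^ (-β) := by
  have hR1 : -R ≤ 1 := by linarith
  calc ‖∫ x : ℝ in (-R)..1, ((x : ℂ) + A * I) ^ (-(β : ℂ)) * exp ((x : ℂ) + A * I)‖
      ≤ ∫ x : ℝ in (-R)..1, A ^ (-β) * Real.exp x := by
        refine intervalIntegral.norm_integral_le_of_norm_le hR1
          (Eventually.of_forall fun x _ ↦ norm_hankelKernel_top_le hA hβ x) ?_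
        exact (continuous_const.mul Real.continuous_exp).intervalIntegrable _ _
    _ = A ^ (-β) * (Real.exp 1 - Real.exp (-R)) := by
        rw [intervalIntegral.integral_const_mul, integral_exp]
    _ ≤ A ^ (-β) * Real.exp 1 := by
        refine mul_le_mul_of_nonneg_left ?_ (Real.rpow_nonneg hA.le _)
        linarith [Real.exp_pos (-R)]
    _ = Real.exp 1 * A ^ (-β) := mul_comm _ _

/-- Left edge: `‖∫_{ε}^{A} (-R+iy)^{-β} e^{-R+iy} dy‖ ≤ A · R^{-β} e^{-R}` (`0 ≤ ε ≤ A`, `R > 0`,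
`β ≥ 0`). [folklore] -/
theorem norm_hankel_left_le {R ε A β : ℝ} (hR : 0 < R) (hε : 0 ≤ ε) (hεA : ε ≤ A) (hβ : 0 ≤ β) :
    ‖∫ y : ℝ in ε..A, (-(R : ℂ) + y * I) ^ (-(β : ℂ)) * exp (-(R : ℂ) + y * I)‖
      ≤ A * (R ^ (-β) * Real.exp (-R)) := by
  calc ‖∫ y : ℝ in ε..A, (-(R : ℂ) + y * I) ^ (-(β : ℂ)) * exp (-(R : ℂ) + y * I)‖
      ≤ (R ^ (-β) * Real.exp (-R)) * |A - ε| :=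
        intervalIntegral.norm_integral_le_of_norm_le_const fun y _ ↦
          norm_hankelKernel_left_le hR hβ y
    _ ≤ (R ^ (-β) * Real.exp (-R)) * A := by
        refine mul_le_mul_of_nonneg_left ?_ (by positivity)
        rw [abs_of_nonneg (by linarith)]
        linarith
    _ = A * (R ^ (-β) * Real.exp (-R)) := mul_comm _ _

/-- Right edge, dependence on the lower end-point: `‖∫_ε^A − ∫_0^A‖ ≤ e · ε` on `Re w = 1`
(`0 ≤ ε`, `β ≥ 0`). [folklore] -/
theorem norm_hankel_right_sub_le {ε β : ℝ} (A : ℝ) (hε : 0 ≤ ε) (hβ : 0 ≤ β) :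
    ‖(∫ y : ℝ in ε..A, ((1 : ℂ) + y * I) ^ (-(β : ℂ)) * exp ((1 : ℂ) + y * I)) -
        ∫ y : ℝ in (0 : ℝ)..A, ((1 : ℂ) + y * I) ^ (-(β : ℂ)) * exp ((1 : ℂ) + y * I)‖
      ≤ Real.exp 1 * ε := by
  have hint : ∀ a b : ℝ, IntervalIntegrable
      (fun y : ℝ ↦ ((1 : ℂ) + y * I) ^ (-(β : ℂ)) * exp ((1 : ℂ) + y * I)) volume a b :=
    fun a b ↦ (continuous_hankelKernel_vertical_of_pos one_pos β).intervalIntegrable a b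
  rw [← integral_add_adjacent_intervals (hint 0 ε) (hint ε A),
    show ∀ a b : ℂ, b - (a + b) = -a from fun a b ↦ by ring, norm_neg]
  calc ‖∫ y : ℝ in (0 : ℝ)..ε, ((1 : ℂ) + y * I) ^ (-(β : ℂ)) * exp ((1 : ℂ) + y * I)‖
      ≤ Real.exp 1 * |ε - 0| :=
        intervalIntegral.norm_integral_le_of_norm_le_const fun y _ ↦
          norm_hankelKernel_right_le hβ y
    _ = Real.exp 1 * ε := by rw [sub_zero, abs_of_nonneg hε]

/-- Left edge, dependence on the lower end-point: `‖∫_ε^A − ∫_0^A‖ ≤ R^{-β}e^{-R} · ε` on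
`Re w = -R` (`0 ≤ ε`, `0 ≤ A`, `R > 0`, `β ≥ 0`). [folklore] -/
theorem norm_hankel_left_sub_le {R ε A β : ℝ} (hR : 0 < R) (hε : 0 ≤ ε) (hA : 0 ≤ A)
    (hβ : 0 ≤ β) :
    ‖(∫ y : ℝ in ε..A, (-(R : ℂ) + y * I) ^ (-(β : ℂ)) * exp (-(R : ℂ) + y * I)) -
        ∫ y : ℝ in (0 : ℝ)..A, (-(R : ℂ) + y * I) ^ (-(β : ℂ)) * exp (-(R : ℂ) + y * I)‖
      ≤ R ^ (-β) * Real.exp (-R) * ε := by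
  have hint : ∀ a b : ℝ, 0 ≤ a → 0 ≤ b → IntervalIntegrable
      (fun y : ℝ ↦ (-(R : ℂ) + y * I) ^ (-(β : ℂ)) * exp (-(R : ℂ) + y * I)) volume a b := by
    intro a b ha hb
    refine ((continuousOn_hankelKernel_left hR.ne' β).mono ?_).intervalIntegrable
    intro y hy
    rw [uIcc_eq_union, mem_union, mem_Icc, mem_Icc] at hy
    rcases hy with hy | hy
    · exact ha.trans hy.1
    · exact hb.trans hy.1
  rw [← integral_add_adjacent_intervals (hint 0 ε le_rfl hε) (hint ε A hε hA),
    show ∀ a b : ℂ, b - (a + b) = -a from fun a b ↦ by ring, norm_neg]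
  calc ‖∫ y : ℝ in (0 : ℝ)..ε, (-(R : ℂ) + y * I) ^ (-(β : ℂ)) * exp (-(R : ℂ) + y * I)‖
      ≤ (R ^ (-β) * Real.exp (-R)) * |ε - 0| :=
        intervalIntegral.norm_integral_le_of_norm_le_const fun y _ ↦
          norm_hankelKernel_left_le hR hβ y
    _ = R ^ (-β) * Real.exp (-R) * ε := by rw [sub_zero, abs_of_nonneg hε]

/-! ## The bottom edge on the real axis -/

/-- On the cut, from above: for `x ≤ 0`, `x^{-β} = (-x)^{-β} e^{-iπβ}` (principal branch).
[folklore] -/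
theorem ofReal_cpow_neg_of_nonpos {x : ℝ} (hx : x ≤ 0) (β : ℝ) :
    (x : ℂ) ^ (-(β : ℂ)) = (((-x) ^ (-β) : ℝ) : ℂ) * exp (-(Real.pi * β) * I) := by
  rw [ofReal_cpow_of_nonpos hx, show (-(β : ℂ)) = ((-β : ℝ) : ℂ) by push_cast; ring,
    ← ofReal_neg, ← ofReal_cpow (by linarith)]
  congr 1
  · push_cast; ring_nf

/-- For `x ≥ 0`, `x^{-β}` is the real power. [folklore] -/
theorem ofReal_cpow_neg_of_nonneg {x : ℝ} (hx : 0 ≤ x) (β : ℝ) :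
    (x : ℂ) ^ (-(β : ℂ)) = ((x ^ (-β) : ℝ) : ℂ) := by
  rw [show (-(β : ℂ)) = ((-β : ℝ) : ℂ) by push_cast; ring, ← ofReal_cpow hx]

/-- The kernel on the negative real axis: `x^{-β}eˣ = ((-x)^{-β}eˣ) · e^{-iπβ}` for `x ≤ 0`.
[folklore] -/
theorem hankelKernel_ofReal_of_nonpos {x : ℝ} (hx : x ≤ 0) (β : ℝ) :
    (x : ℂ) ^ (-(β : ℂ)) * exp (x : ℂ) =
      (((-x) ^ (-β) * Real.exp x : ℝ) : ℂ) * exp (-(Real.pi * β) * I) := by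
  rw [ofReal_cpow_neg_of_nonpos hx]
  push_cast
  ring

/-- The kernel on the positive real axis is real: `x^{-β}eˣ` for `x ≥ 0`. [folklore] -/
theorem hankelKernel_ofReal_of_nonneg {x : ℝ} (hx : 0 ≤ x) (β : ℝ) :
    (x : ℂ) ^ (-(β : ℂ)) * exp (x : ℂ) = ((x ^ (-β) * Real.exp x : ℝ) : ℂ) := by
  rw [ofReal_cpow_neg_of_nonneg hx]
  push_cast
  ring

/-- `x ↦ |x|^{-β}` is interval integrable on every interval when `β < 1`. [folklore] -/
theorem intervalIntegrable_abs_rpow_neg {β : ℝ} (hβ : β < 1) (a b : ℝ) :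
    IntervalIntegrable (fun x : ℝ ↦ |x| ^ (-β)) volume a b := by
  have hr : -1 < -β := by linarith
  -- on `[0, c]`, `c ≥ 0`
  have hpos : ∀ c : ℝ, 0 ≤ c → IntervalIntegrable (fun x : ℝ ↦ |x| ^ (-β)) volume 0 c := by
    intro c hc
    refine (intervalIntegral.intervalIntegrable_rpow' hr).congr fun x hx ↦ ?_
    rw [uIoc_of_le hc] at hx
    simp [abs_of_pos hx.1]
  -- on `[c, 0]`, `c ≤ 0`, by the reflection `x ↦ -x`
  have hneg : ∀ c : ℝ, c ≤ 0 → IntervalIntegrable (fun x : ℝ ↦ |x| ^ (-β)) volume 0 c := by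
    intro c hc
    have h := (intervalIntegral.intervalIntegrable_rpow' (a := 0) (b := -c) hr).comp_sub_left 0
    simp only [sub_zero, zero_sub, neg_neg] at h
    refine h.congr fun x hx ↦ ?_
    rw [uIoc_of_ge hc] at hx
    simp [abs_of_nonpos hx.2]
  have h0 : ∀ c : ℝ, IntervalIntegrable (fun x : ℝ ↦ |x| ^ (-β)) volume 0 c := fun c ↦ by
    rcases le_total 0 c with hc | hc
    · exact hpos c hc
    · exact hneg c hc
  exact (h0 a).symm.trans (h0 b)

/-- The real-axis kernel is interval integrable (`β < 1`; the singularity `|x|^{-β}` at `0` is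
integrable). [folklore] -/
theorem intervalIntegrable_hankelKernel_ofReal {β : ℝ} (hβ : β < 1) (a b : ℝ) :
    IntervalIntegrable (fun x : ℝ ↦ (x : ℂ) ^ (-(β : ℂ)) * exp (x : ℂ)) volume a b := by
  have hbound : IntervalIntegrable (fun x : ℝ ↦ |x| ^ (-β) * Real.exp (max |a| |b|)) volume a b :=
    (intervalIntegrable_abs_rpow_neg hβ a b).mul_const _
  refine hbound.mono_fun' (measurable_hankelKernel_horizontal 0 β |>.aestronglyMeasurable.congr
    ?_ |>.restrict) ?_
  · exact Eventually.of_forall fun x ↦ by simp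
  · rw [EventuallyLE, ae_restrict_iff' measurableSet_uIoc]
    filter_upwards [measure_eq_zero_iff_ae_notMem.1 (measure_singleton (0 : ℝ))] with x hx0 hx
    have hx0' : x ≠ 0 := fun h ↦ hx0 (by simp [h])
    rw [norm_hankelKernel, norm_real, Real.norm_eq_abs, ofReal_re]
    refine mul_le_mul_of_nonneg_left (Real.exp_le_exp.2 ?_) (Real.rpow_nonneg (abs_nonneg x) _)
    have : x ∈ [[a, b]] := uIoc_subset_uIcc hx
    rw [mem_uIcc] at this
    rcases this with h | h
    · exact h.2.trans ((le_abs_self b).trans (le_max_right _ _))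
    · exact h.2.trans ((le_abs_self a).trans (le_max_left _ _))

/-- **Value of the bottom edge on the real axis.** For `R ≥ 0` and `β < 1`,
`Im ∫_{-R}^{1} x^{-β} eˣ dx = -sin(πβ) ∫_0^R r^{-β} e^{-r} dr` (principal branch on the cut; the piece
over `[0,1]` is real). [folklore] -/
theorem im_hankel_bottom_zero {R β : ℝ} (hR : 0 ≤ R) (hβ : β < 1) :
    (∫ x : ℝ in (-R)..1, (x : ℂ) ^ (-(β : ℂ)) * exp (x : ℂ)).im =
      -Real.sin (Real.pi * β) * ∫ r : ℝ in (0 : ℝ)..R, r ^ (-β) * Real.exp (-r) := by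
  have hint := intervalIntegrable_hankelKernel_ofReal hβ
  rw [← integral_add_adjacent_intervals (hint (-R) 0) (hint 0 1), add_im]
  -- the piece over `[0, 1]` is real
  have h01 : (∫ x : ℝ in (0 : ℝ)..1, (x : ℂ) ^ (-(β : ℂ)) * exp (x : ℂ)) =
      ((∫ x : ℝ in (0 : ℝ)..1, x ^ (-β) * Real.exp x : ℝ) : ℂ) := by
    rw [← intervalIntegral.integral_ofReal]
    refine intervalIntegral.integral_congr fun x hx ↦ ?_
    rw [uIcc_of_le zero_le_one] at hx
    exact hankelKernel_ofReal_of_nonneg hx.1 β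
  -- the piece over `[-R, 0]`
  have hR0 : (∫ x : ℝ in (-R)..0, (x : ℂ) ^ (-(β : ℂ)) * exp (x : ℂ)) =
      ((∫ r : ℝ in (0 : ℝ)..R, r ^ (-β) * Real.exp (-r) : ℝ) : ℂ) * exp (-(Real.pi * β) * I) := by
    have h1 : (∫ x : ℝ in (-R)..0, (x : ℂ) ^ (-(β : ℂ)) * exp (x : ℂ)) =
        ∫ x : ℝ in (-R)..0, (((-x) ^ (-β) * Real.exp x : ℝ) : ℂ) * exp (-(Real.pi * β) * I) := by
      refine intervalIntegral.integral_congr fun x hx ↦ ?_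
      rw [uIcc_of_le (by linarith : -R ≤ 0)] at hx
      exact hankelKernel_ofReal_of_nonpos hx.2 β
    rw [h1, intervalIntegral.integral_mul_const, intervalIntegral.integral_ofReal]
    congr 2
    have h2 := intervalIntegral.integral_comp_neg (a := -R) (b := 0)
      (f := fun r : ℝ ↦ r ^ (-β) * Real.exp (-r))
    simp only [neg_neg, neg_zero] at h2
    exact h2
  rw [h01, hR0, ofReal_im, add_zero,
    show (-((Real.pi : ℂ) * β)) * I = ((-(Real.pi * β) : ℝ) : ℂ) * I by push_cast; ring,
    mul_im, ofReal_re, ofReal_im, zero_mul, add_zero, exp_ofReal_mul_I_im, Real.sin_neg]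
  ring

/-- **The bottom edge tends to the real-axis integral** as its height `ε → 0⁺` (`R ≥ 0`,
`0 ≤ β < 1`): dominated convergence with the integrable majorant `e·|x|^{-β}` and continuity of the
principal branch from above on the cut. [folklore] -/
theorem tendsto_hankel_bottom {R β : ℝ} (hR : 0 ≤ R) (hβ0 : 0 ≤ β) (hβ : β < 1) :
    Tendsto (fun ε : ℝ ↦ ∫ x : ℝ in (-R)..1, ((x : ℂ) + ε * I) ^ (-(β : ℂ)) * exp ((x : ℂ) + ε * I))
      (𝓝[>] 0) (𝓝 (∫ x : ℝ in (-R)..1, (x : ℂ) ^ (-(β : ℂ)) * exp (x : ℂ))) := by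
  have hae : ∀ᵐ x : ℝ, x ∉ ({0} : Set ℝ) :=
    measure_eq_zero_iff_ae_notMem.1 (measure_singleton (0 : ℝ))
  have key : ContinuousWithinAt
      (fun ε : ℝ ↦ ∫ x : ℝ in (-R)..1, ((x : ℂ) + ε * I) ^ (-(β : ℂ)) * exp ((x : ℂ) + ε * I))
      (Ioi 0) 0 := by
    refine intervalIntegral.continuousWithinAt_of_dominated_interval
      (bound := fun x : ℝ ↦ |x| ^ (-β) * Real.exp 1) ?_ ?_ ?_ ?_
    · exact Eventually.of_forall fun ε ↦
        (measurable_hankelKernel_horizontal ε β).aestronglyMeasurable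
    · refine Eventually.of_forall fun ε ↦ ?_
      filter_upwards [hae] with x hx0 hx
      have hx0' : x ≠ 0 := fun h ↦ hx0 (by simp [h])
      rw [uIoc_of_le (by linarith : -R ≤ 1)] at hx
      rw [norm_hankelKernel]
      have hre : ((x : ℂ) + ε * I).re = x := by simp
      rw [hre]
      refine mul_le_mul (Real.rpow_le_rpow_of_nonpos (abs_pos.2 hx0') ?_ (by linarith))
        (Real.exp_le_exp.2 hx.2) (Real.exp_pos x).le (Real.rpow_nonneg (abs_nonneg _) _)
      calc |x| = |((x : ℂ) + ε * I).re| := by simp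
        _ ≤ ‖(x : ℂ) + ε * I‖ := abs_re_le_norm _
    · exact (intervalIntegrable_abs_rpow_neg hβ _ _).mul_const _
    · filter_upwards [hae] with x hx0 _
      have hx0' : x ≠ 0 := fun h ↦ hx0 (by simp [h])
      have hc : Continuous fun ε : ℝ ↦ (x : ℂ) + ε * I := by fun_prop
      have hmaps : MapsTo (fun ε : ℝ ↦ (x : ℂ) + ε * I) (Ioi 0) {z : ℂ | 0 ≤ z.im} := by
        intro ε hε
        simpa using (mem_Ioi.1 hε).le
      have hw : ((x : ℂ) + ((0 : ℝ) : ℂ) * I) ≠ 0 := by simpa using hx0'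
      exact (continuousWithinAt_hankelKernel hw β).comp (f := fun ε : ℝ ↦ (x : ℂ) + ε * I)
        hc.continuousWithinAt hmaps
  simpa using key.tendsto

/-! ## Assembly: the right edge in terms of the cut integral -/

/-- **The right edge through the cut** (`R > 0`, `A > 0`, `0 ≤ β < 1`):
`Re ∫_0^A (1+iy)^{-β} e^{1+iy} dy = sin(πβ) ∫_0^R r^{-β}e^{-r} dr + Im(top edge) + Re(left edge)`,
obtained from Cauchy's theorem on `[-R,1] × [ε,A]` by letting `ε → 0⁺`. [folklore] -/
theorem re_hankel_right_eq {R A β : ℝ} (hR : 0 < R) (hA : 0 < A) (hβ0 : 0 ≤ β) (hβ : β < 1) :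
    (∫ y : ℝ in (0 : ℝ)..A, ((1 : ℂ) + y * I) ^ (-(β : ℂ)) * exp ((1 : ℂ) + y * I)).re =
      Real.sin (Real.pi * β) * (∫ r : ℝ in (0 : ℝ)..R, r ^ (-β) * Real.exp (-r)) +
      (∫ x : ℝ in (-R)..1, ((x : ℂ) + A * I) ^ (-(β : ℂ)) * exp ((x : ℂ) + A * I)).im +
      (∫ y : ℝ in (0 : ℝ)..A, (-(R : ℂ) + y * I) ^ (-(β : ℂ)) * exp (-(R : ℂ) + y * I)).re := by
  set Rt : ℝ → ℂ := fun ε ↦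
    ∫ y : ℝ in ε..A, ((1 : ℂ) + y * I) ^ (-(β : ℂ)) * exp ((1 : ℂ) + y * I) with hRt
  set Bt : ℝ → ℂ := fun ε ↦
    ∫ x : ℝ in (-R)..1, ((x : ℂ) + ε * I) ^ (-(β : ℂ)) * exp ((x : ℂ) + ε * I) with hBt
  set Lt : ℝ → ℂ := fun ε ↦
    ∫ y : ℝ in ε..A, (-(R : ℂ) + y * I) ^ (-(β : ℂ)) * exp (-(R : ℂ) + y * I) with hLt
  set Tp : ℂ := ∫ x : ℝ in (-R)..1, ((x : ℂ) + A * I) ^ (-(β : ℂ)) * exp ((x : ℂ) + A * I)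
    with hTp
  set B₀ : ℂ := ∫ x : ℝ in (-R)..1, (x : ℂ) ^ (-(β : ℂ)) * exp (x : ℂ) with hB₀
  -- Cauchy, for `0 < ε < A`
  have h1 : ∀ ε ∈ Ioo 0 A, (Rt ε).re + (Bt ε).im - (Lt ε).re = Tp.im := by
    intro ε hε
    have h := congrArg Complex.im (hankel_rect_eq_zero (R := R) hε.1 hε.2.le β)
    simp only [sub_im, add_im, I_mul_im, zero_im] at h
    simp only [hRt, hBt, hLt, hTp]
    linarith
  -- the three edges have limits as `ε → 0⁺`
  have hRt_lim : Tendsto Rt (𝓝[>] 0) (𝓝 (Rt 0)) := by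
    refine tendsto_iff_norm_sub_tendsto_zero.2 ?_
    refine squeeze_zero' (Eventually.of_forall fun ε ↦ norm_nonneg _) ?_
      (tendsto_nhdsWithin_of_tendsto_nhds (by
        simpa using ((continuous_const.mul continuous_id).tendsto (0 : ℝ) :
          Tendsto (fun ε : ℝ ↦ Real.exp 1 * ε) (𝓝 0) (𝓝 (Real.exp 1 * 0)))))
    filter_upwards [self_mem_nhdsWithin] with ε hε
    exact norm_hankel_right_sub_le A (mem_Ioi.1 hε).le hβ0
  have hLt_lim : Tendsto Lt (𝓝[>] 0) (𝓝 (Lt 0)) := by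
    refine tendsto_iff_norm_sub_tendsto_zero.2 ?_
    refine squeeze_zero' (Eventually.of_forall fun ε ↦ norm_nonneg _) ?_
      (tendsto_nhdsWithin_of_tendsto_nhds (by
        simpa using ((continuous_const.mul continuous_id).tendsto (0 : ℝ) :
          Tendsto (fun ε : ℝ ↦ R ^ (-β) * Real.exp (-R) * ε) (𝓝 0)
            (𝓝 (R ^ (-β) * Real.exp (-R) * 0)))))
    filter_upwards [self_mem_nhdsWithin] with ε hε
    exact norm_hankel_left_sub_le hR (mem_Ioi.1 hε).le hA.le hβ0
  have hBt_lim : Tendsto Bt (𝓝[>] 0) (𝓝 B₀) := tendsto_hankel_bottom hR.le hβ0 hβ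
  have hlim : Tendsto (fun ε ↦ (Rt ε).re + (Bt ε).im - (Lt ε).re) (𝓝[>] 0)
      (𝓝 ((Rt 0).re + B₀.im - (Lt 0).re)) :=
    ((continuous_re.tendsto _ |>.comp hRt_lim).add (continuous_im.tendsto _ |>.comp hBt_lim)).sub
      (continuous_re.tendsto _ |>.comp hLt_lim)
  have hconst : Tendsto (fun ε ↦ (Rt ε).re + (Bt ε).im - (Lt ε).re) (𝓝[>] 0) (𝓝 Tp.im) := by
    refine tendsto_const_nhds.congr' ?_
    filter_upwards [Ioo_mem_nhdsGT hA] with ε hε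
    exact (h1 ε hε).symm
  have heq := tendsto_nhds_unique hlim hconst
  have hB₀ : B₀.im = -Real.sin (Real.pi * β) * ∫ r : ℝ in (0 : ℝ)..R, r ^ (-β) * Real.exp (-r) :=
    im_hankel_bottom_zero hR.le hβ
  rw [hB₀] at heq
  have : (Rt 0).re = Real.sin (Real.pi * β) * (∫ r : ℝ in (0 : ℝ)..R, r ^ (-β) * Real.exp (-r)) +
      Tp.im + (Lt 0).re := by linarith
  simpa [hRt, hLt, hTp] using this

/-- **Conjugation symmetry**: the line integral over `|y| ≤ A` is twice the real part of the
integral over `[0, A]` (the kernel commutes with complex conjugation off the cut). [folklore] -/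
theorem hankel_line_eq_two_re {A : ℝ} (hA : 0 ≤ A) (β : ℝ) :
    (∫ y : ℝ in (-A)..A, ((1 : ℂ) + y * I) ^ (-(β : ℂ)) * exp ((1 : ℂ) + y * I)) =
      ((2 * (∫ y : ℝ in (0 : ℝ)..A,
        ((1 : ℂ) + y * I) ^ (-(β : ℂ)) * exp ((1 : ℂ) + y * I)).re : ℝ) : ℂ) := by
  set f : ℝ → ℂ := fun y ↦ ((1 : ℂ) + y * I) ^ (-(β : ℂ)) * exp ((1 : ℂ) + y * I) with hf
  have hint : ∀ a b : ℝ, IntervalIntegrable f volume a b :=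
    fun a b ↦ (continuous_hankelKernel_vertical_of_pos one_pos β).intervalIntegrable a b
  have hconj : ∀ y : ℝ, f (-y) = starRingEnd ℂ (f y) := by
    intro y
    have hw : starRingEnd ℂ ((1 : ℂ) + y * I) = (1 : ℂ) + ((-y : ℝ) : ℂ) * I := by
      apply Complex.ext <;> simp
    have harg : ((1 : ℂ) + y * I).arg ≠ Real.pi := by
      rw [Ne, arg_eq_pi_iff, not_and_or]
      exact Or.inl (by simp)
    simp only [hf, map_mul, ← exp_conj, hw]
    congr 1
    rw [← hw, conj_cpow _ _ harg, map_neg, conj_ofReal]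
  have hneg : (∫ y : ℝ in (-A)..0, f y) = starRingEnd ℂ (∫ y : ℝ in (0 : ℝ)..A, f y) := by
    have h1 := intervalIntegral.integral_comp_neg (a := 0) (b := A) (f := f)
    rw [neg_zero] at h1
    rw [← h1, intervalIntegral.integral_of_le hA, intervalIntegral.integral_of_le hA,
      ← integral_conj]
    exact integral_congr_ae (Eventually.of_forall fun y ↦ hconj y)
  rw [← integral_add_adjacent_intervals (hint (-A) 0) (hint 0 A), hneg, add_comm, add_conj]

/-! ## The truncated vertical Hankel integral -/

/-- For `R ≥ 1`, `A > 0`, `0 ≤ β < 1`: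
`‖∫_{-A}^{A} (1+iy)^{-β}e^{1+iy} dy − 2 sin(πβ) ∫_0^R r^{-β}e^{-r} dr‖ ≤ 2e·A^{-β} + 2A·R^{-β}e^{-R}`.
[folklore] -/
theorem norm_hankel_line_sub_cut_le {R A β : ℝ} (hR : 1 ≤ R) (hA : 0 < A) (hβ0 : 0 ≤ β)
    (hβ : β < 1) :
    ‖(∫ y : ℝ in (-A)..A, ((1 : ℂ) + y * I) ^ (-(β : ℂ)) * exp ((1 : ℂ) + y * I)) -
        ((2 * Real.sin (Real.pi * β) * ∫ r : ℝ in (0 : ℝ)..R, r ^ (-β) * Real.exp (-r) : ℝ) : ℂ)‖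
      ≤ 2 * Real.exp 1 * A ^ (-β) + 2 * A * (R ^ (-β) * Real.exp (-R)) := by
  have hR0 : 0 < R := by linarith
  rw [hankel_line_eq_two_re hA.le, re_hankel_right_eq hR0 hA hβ0 hβ, ← ofReal_sub, norm_real,
    Real.norm_eq_abs]
  set Tp : ℂ := ∫ x : ℝ in (-R)..1, ((x : ℂ) + A * I) ^ (-(β : ℂ)) * exp ((x : ℂ) + A * I)
    with hTp
  set L₀ : ℂ := ∫ y : ℝ in (0 : ℝ)..A, (-(R : ℂ) + y * I) ^ (-(β : ℂ)) * exp (-(R : ℂ) + y * I)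
    with hL₀
  have hT : ‖Tp‖ ≤ Real.exp 1 * A ^ (-β) := norm_hankel_top_le (by linarith) hA hβ0
  have hL : ‖L₀‖ ≤ A * (R ^ (-β) * Real.exp (-R)) := norm_hankel_left_le hR0 le_rfl hA.le hβ0
  have h1 : |Tp.im| ≤ ‖Tp‖ := abs_im_le_norm _
  have h2 : |L₀.re| ≤ ‖L₀‖ := abs_re_le_norm _
  rw [show 2 * (Real.sin (Real.pi * β) * (∫ r : ℝ in (0 : ℝ)..R, r ^ (-β) * Real.exp (-r)) +
      Tp.im + L₀.re) - 2 * Real.sin (Real.pi * β) * ∫ r : ℝ in (0 : ℝ)..R, r ^ (-β) * Real.exp (-r)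
      = 2 * Tp.im + 2 * L₀.re by ring]
  calc |2 * Tp.im + 2 * L₀.re| ≤ |2 * Tp.im| + |2 * L₀.re| := abs_add_le _ _
    _ = 2 * |Tp.im| + 2 * |L₀.re| := by
        rw [abs_mul, abs_mul, abs_of_pos (by norm_num : (0 : ℝ) < 2)]
    _ ≤ 2 * (Real.exp 1 * A ^ (-β)) + 2 * (A * (R ^ (-β) * Real.exp (-R))) := by
        gcongr
        · exact h1.trans hT
        · exact h2.trans hL
    _ = 2 * Real.exp 1 * A ^ (-β) + 2 * A * (R ^ (-β) * Real.exp (-R)) := by ring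

/-- The cut integral tends to `Γ(1-β)`: `∫_0^R r^{-β} e^{-r} dr → Γ(1-β)` (`β < 1`). [folklore] -/
theorem tendsto_cutIntegral_Gamma {β : ℝ} (hβ : β < 1) :
    Tendsto (fun R : ℝ ↦ ∫ r : ℝ in (0 : ℝ)..R, r ^ (-β) * Real.exp (-r)) atTop
      (𝓝 (Real.Gamma (1 - β))) := by
  have h1β : 0 < 1 - β := by linarith
  rw [Real.Gamma_eq_integral h1β]
  have h := intervalIntegral_tendsto_integral_Ioi 0 (Real.GammaIntegral_convergent h1β) tendsto_id
  refine h.congr fun R ↦ ?_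
  simp only [id]
  refine intervalIntegral.integral_congr fun r _ ↦ ?_
  rw [show (1 : ℝ) - β - 1 = -β by ring, mul_comm]

/-- Euler's reflection formula in the form used here: `2 sin(πβ) Γ(1-β) = 2π/Γ(β)` (`0 < β < 1`).
[folklore] -/
theorem two_sin_mul_Gamma_one_sub {β : ℝ} (hβ0 : 0 < β) (hβ : β < 1) :
    2 * Real.sin (Real.pi * β) * Real.Gamma (1 - β) = 2 * Real.pi / Real.Gamma β := by
  have hΓ : 0 < Real.Gamma β := Real.Gamma_pos_of_pos hβ0
  have hsin : 0 < Real.sin (Real.pi * β) :=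
    Real.sin_pos_of_pos_of_lt_pi (by positivity) (by nlinarith [Real.pi_pos])
  have h := Real.Gamma_mul_Gamma_one_sub β
  rw [eq_div_iff hsin.ne'] at h
  field_simp
  linarith

/-- **The truncated vertical Hankel integral.** For `0 < β < 1` and `A > 0`,
`‖∫_{-A}^{A} (1+iy)^{-β} e^{1+iy} dy − 2π/Γ(β)‖ ≤ 2e · A^{-β}`; that is,
`(1/2πi) ∫_{1-iA}^{1+iA} w^{-β} e^{w} dw = 1/Γ(β) + O(A^{-β})`, the truncation of Hankel's
(Laplace-inversion) formula `(1/2πi)∫_{1-i∞}^{1+i∞} w^{-β}e^{w} dw = 1/Γ(β)`. Proof: Cauchy's theorem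
on `[-R,1] × [ε,A]`, `ε → 0⁺` onto the cut (dominated convergence), conjugation symmetry for the lower
half-plane, `∫_0^∞ r^{-β}e^{-r}dr = Γ(1-β)`, `R → ∞`, and the reflection formula. [folklore] -/
theorem norm_hankelLineIntegral_sub_le {β A : ℝ} (hβ0 : 0 < β) (hβ : β < 1) (hA : 0 < A) :
    ‖(∫ y : ℝ in (-A)..A, ((1 : ℂ) + y * I) ^ (-(β : ℂ)) * exp ((1 : ℂ) + y * I)) -
        ((2 * Real.pi / Real.Gamma β : ℝ) : ℂ)‖ ≤ 2 * Real.exp 1 * A ^ (-β) := by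
  set J : ℂ := ∫ y : ℝ in (-A)..A, ((1 : ℂ) + y * I) ^ (-(β : ℂ)) * exp ((1 : ℂ) + y * I) with hJ
  set IR : ℝ → ℝ := fun R ↦ ∫ r : ℝ in (0 : ℝ)..R, r ^ (-β) * Real.exp (-r) with hIR
  -- the left-hand side as a limit `R → ∞`
  have hlhs : Tendsto (fun R : ℝ ↦ ‖J - ((2 * Real.sin (Real.pi * β) * IR R : ℝ) : ℂ)‖) atTop
      (𝓝 ‖J - ((2 * Real.pi / Real.Gamma β : ℝ) : ℂ)‖) := by
    rw [← two_sin_mul_Gamma_one_sub hβ0 hβ]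
    have h1 : Tendsto (fun R : ℝ ↦ 2 * Real.sin (Real.pi * β) * IR R) atTop
        (𝓝 (2 * Real.sin (Real.pi * β) * Real.Gamma (1 - β))) :=
      (tendsto_cutIntegral_Gamma hβ).const_mul _
    exact ((continuous_ofReal.tendsto _).comp h1 |>.const_sub J).norm
  -- the right-hand side as a limit `R → ∞`
  have hrhs : Tendsto (fun R : ℝ ↦ 2 * Real.exp 1 * A ^ (-β) + 2 * A * (R ^ (-β) * Real.exp (-R)))
      atTop (𝓝 (2 * Real.exp 1 * A ^ (-β))) := by
    have h0 : Tendsto (fun R : ℝ ↦ R ^ (-β) * Real.exp (-R)) atTop (𝓝 0) := by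
      refine squeeze_zero' ?_ ?_ Real.tendsto_exp_neg_atTop_nhds_zero
      · filter_upwards [eventually_ge_atTop 0] with R hR
        exact mul_nonneg (Real.rpow_nonneg hR _) (Real.exp_pos _).le
      · filter_upwards [eventually_ge_atTop 1] with R hR
        have : R ^ (-β) ≤ 1 := Real.rpow_le_one_of_one_le_of_nonpos hR (by linarith)
        calc R ^ (-β) * Real.exp (-R) ≤ 1 * Real.exp (-R) :=
              mul_le_mul_of_nonneg_right this (Real.exp_pos _).le
          _ = Real.exp (-R) := one_mul _
    simpa using (h0.const_mul (2 * A)).const_add (2 * Real.exp 1 * A ^ (-β))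
  refine le_of_tendsto_of_tendsto hlhs hrhs ?_
  filter_upwards [eventually_ge_atTop 1] with R hR
  exact norm_hankel_line_sub_cut_le hR hA hβ0.le hβ

end Literature.Barriers.RiemannHypothesis

end
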